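/-
Copyright (c) 2026 the pub-hodgecm-mathlib formalisation cell (harness21).  Prover seat hodgecm-mathlib-K2Liu-p06 (g4), Track B «K2-LIT»,
#184♮ = hLiu418 = `stmt-HodgeConjecture-24832`; #42S payer road, organ S1 (local Siegel–Weil spanning), ROAD W file F3c-B2 (geometry of the big cell:
the Levi SCALARS `m(a)` — the contracting elements of ★ F3b `spanning_criterion`, algebraic part; RULINGS «M-157t», «M-158a»).
-/
import Summits.HodgeConjecture.HodgeConjecture.Theorems.K2LiuLocalSWBigCellDecomposition   -- ★ F3c-A (and ★ `unipDeltaLocal`, `nElem`, `weylDelta`, `ofAdapted`)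
import HarnessLib

/-!
# Crux `HLiu418`, #42S organ S1, ROAD W, file F3c-B2: THE LEVI SCALARS `m(a) = diag(a, a⁻¹)` OF THE LOCAL DOUBLED UNITARY GROUP
# (`m(a) ∈ P_Δ`, `w_Δ m(a) = m(a⁻¹) w_Δ`, `m(a) n(t) m(a)⁻¹ = n(a² t)`: the dilations of ★ F3a's lattice lemma and the `hcontr` binder of ★ F3b)

Cell `hodgecm-mathlib`, crux item hLiu418 = `stmt-HodgeConjecture-24832`; squad K2 ∕ K2Liu; prover K2Liu-p06 (g4), the dedicated S1 hand.
THEOREMS ONLY (no `def`, no instance, no notation, no named-fact hypothesis, no `sorry`); lane `--supports stmt-HodgeConjecture-24832 --as helper`.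

For `a ∈ F_vˣ` (read in `E ⊗ F_v` through ★ `toLocalRing`, so `σ`-fixed: ★ `conjLocal_toLocalRing`) the matrix `Y_a = [[a·1, 0], [0, a⁻¹·1]]` in the `Δ`-adapted frame
preserves the adapted form `antidiag(2T, 2T)` (`cstar_leviScalar`), so ★ `ofAdapted` produces an element `m(a) ∈ H(F_v)` — inline, no definition — with:
`m(a) ∈ P_Δ` (`C = 0`), `w_Δ · m(a) = m(a⁻¹) · w_Δ` (`weylDelta_mul_leviScalar`), `m(a) · m(a⁻¹) = 1`, and the DILATION of the unipotent radical
`m(a) · u · m(a)⁻¹ ∈ N_Δ(F_v)` with adapted coordinate `B(m(a) u m(a)⁻¹) = a² · B(u)` (`leviScalar_conj_mem_unipDeltaLocal`, `blkB_leviScalar_conj`) — packaged as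
**`exists_leviScalar`**: for every `a ≠ 0` there are `m, m′ ∈ P_Δ(F_v)` with these five properties (the algebraic content of the `hcontr` binder of ★ F3b
`spanning_criterion`; the topological choice of `a` small is F3c-B3).  Generic GR91 local doubled datum (any `n`, any finite `v`).
References: [Kudla1994] §3 (the Siegel Levi `M_Δ ≅ GL(Δ)`); [HarrisKudlaSweet1996] §1 (1.11); [BernsteinZelevinsky1976] §1.5.
HONEST LABEL.  Count-neutral helper: `HC_CM` is proved only modulo the 7 printed citations (2 remaining named inputs: hLiu418 = `stmt-HodgeConjecture-24832`,
h413 = `stmt-HodgeConjecture-24833`) until rung 0 closes.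
-/

set_option autoImplicit false
set_option linter.dupNamespace false -- the mandated namespace repeats `HodgeConjecture.HodgeConjecture`

noncomputable section

open NumberField IsDedekindDomain Matrix
open Literature.NumberTheory.Automorphic Literature.NumberTheory.Automorphic.UnitaryGroup
open Literature.NumberTheory.GelbartRogawski1991.AdaptedBlocks
open Literature.NumberTheory.GelbartRogawski1991.UnitaryDualPair.LocalSplitting
open Literature.NumberTheory.K2Lit.LocalSiegelDoubled
open Summit.HodgeConjecture.HodgeConjecture.Cruxes.HLiu418.K2LiuLocalSWBigCellDecomposition

namespace Summit.HodgeConjecture.HodgeConjecture.Cruxes.HLiu418.K2LiuLocalSWLeviScalars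

variable (F : Type) [Field F] [NumberField F] (E : Type) [Field E] [NumberField E] [Algebra F E]
  (c : E ≃ₐ[F] E)
  {δ : E} (hcδ : c δ = -δ) (hδ : δ ≠ 0) {d : F} (hd : δ * δ = algebraMap F E d)
  (v : HeightOneSpectrum (𝓞 F)) (n : ℕ) {T₀ : Matrix (Fin n) (Fin n) F} (hT₀ : T₀.IsSymm) (hT₀d : IsUnit T₀.det)
  {JD : Matrix (Fin (n + n)) (Fin (n + n)) E} (hJD : JD = (gramD F n T₀).map (algebraMap F E))

/-! ## §1 The adapted matrix `Y_a = diag(a·1, a⁻¹·1)` -/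

/-- `det Y_a` is a unit for `a ≠ 0`. [cite: Kudla1994, §3] -/
theorem isUnit_det_leviScalar {a : v.adicCompletion F} (ha : a ≠ 0) :
    IsUnit (Matrix.fromBlocks (toLocalRing E v a • (1 : Matrix (Fin n) (Fin n) (LocalRing E v))) 0 0
      (toLocalRing E v a⁻¹ • (1 : Matrix (Fin n) (Fin n) (LocalRing E v)))).det := by
  rw [Matrix.det_fromBlocks_zero₂₁, Matrix.det_smul, Matrix.det_smul, Matrix.det_one, mul_one, mul_one]
  exact (((IsUnit.mk0 a ha).map (toLocalRing E v)).pow _).mul (((IsUnit.mk0 a⁻¹ (inv_ne_zero ha)).map (toLocalRing E v)).pow _)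

/-- `σ(b · 1) = b · 1` for `b ∈ F_v` (★ `conjLocal_toLocalRing`). [folklore] -/
theorem map_conjLocal_smul_one (b : v.adicCompletion F) :
    ((toLocalRing E v b • (1 : Matrix (Fin n) (Fin n) (LocalRing E v))).map (conjLocal E c v)) = toLocalRing E v b • 1 := by
  refine Matrix.ext fun i j => ?_
  simp only [Matrix.map_apply, Matrix.smul_apply, Matrix.one_apply, smul_eq_mul, mul_ite, mul_one, mul_zero, apply_ite (conjLocal E c v), map_zero,
    conjLocal_toLocalRing]

/-- `Y_a` preserves the adapted form `antidiag(2T, 2T)` (`σ` fixes `a ∈ F_v`, scalars commute). [cite: Kudla1994, §3] [cite: HarrisKudlaSweet1996, §1 (1.11)] -/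
theorem cstar_leviScalar {a : v.adicCompletion F} (ha : a ≠ 0) :
    ((Matrix.fromBlocks (toLocalRing E v a • (1 : Matrix (Fin n) (Fin n) (LocalRing E v))) 0 0
        (toLocalRing E v a⁻¹ • (1 : Matrix (Fin n) (Fin n) (LocalRing E v)))).map (conjLocal E c v))ᵀ *
        adForm F E v n (T₀ := T₀) *
        Matrix.fromBlocks (toLocalRing E v a • (1 : Matrix (Fin n) (Fin n) (LocalRing E v))) 0 0
          (toLocalRing E v a⁻¹ • (1 : Matrix (Fin n) (Fin n) (LocalRing E v))) =
      adForm F E v n (T₀ := T₀) := by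
  rw [Matrix.fromBlocks_map, map_conjLocal_smul_one, map_conjLocal_smul_one, Matrix.map_zero _ (map_zero _), Matrix.fromBlocks_transpose,
    Matrix.transpose_smul, Matrix.transpose_smul, Matrix.transpose_one, Matrix.transpose_zero, adForm, Matrix.fromBlocks_multiply, Matrix.fromBlocks_multiply]
  have hu : toLocalRing E v a⁻¹ * toLocalRing E v a = 1 := by rw [← map_mul, inv_mul_cancel₀ ha, map_one]
  have hu' : toLocalRing E v a * toLocalRing E v a⁻¹ = 1 := by rw [← map_mul, mul_inv_cancel₀ ha, map_one]
  simp only [Matrix.smul_mul, Matrix.mul_smul, Matrix.one_mul, Matrix.mul_one, Matrix.zero_mul, Matrix.mul_zero, add_zero, zero_add, smul_zero,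
    smul_smul]
  rw [show toLocalRing E v a⁻¹ * (2 * toLocalRing E v a) = 2 by rw [mul_left_comm, hu, mul_one],
    show toLocalRing E v a * (2 * toLocalRing E v a⁻¹) = 2 by rw [mul_left_comm, hu', mul_one]]

/-! ## §2 The elements `m(a)` and their algebra -/

include hcδ hδ hd hT₀ in
/-- **THE LEVI SCALARS.**  For `a ∈ F_v`, `a ≠ 0`, there are `m, m′ ∈ P_Δ(F_v)` with adapted matrices `diag(a, a⁻¹)`, `diag(a⁻¹, a)`, `m m′ = 1`,
`w_Δ m = m′ w_Δ`, and conjugation by `m` (resp. `m′ = m⁻¹`) preserving `N_Δ(F_v)` with `B ↦ a² B` (resp. `B ↦ a⁻² B`).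
[cite: Kudla1994, §3] [cite: HarrisKudlaSweet1996, §1 (1.11)] [cite: BernsteinZelevinsky1976, §1.5] -/
theorem exists_leviScalar [Algebra.IsQuadraticExtension F E] {a : v.adicCompletion F} (ha : a ≠ 0) :
    ∃ m m' : UnitaryGroup.localPi E c (n + n) JD v,
      IsSiegelDelta F E c hcδ hδ hd v n hT₀ hJD m ∧ IsSiegelDelta F E c hcδ hδ hd v n hT₀ hJD m' ∧ m * m' = 1 ∧
      weylDelta F E c v n hJD * m = m' * weylDelta F E c v n hJD ∧
      (∀ u ∈ unipDeltaLocal F E c v n (JD := JD), m * u * m⁻¹ ∈ unipDeltaLocal F E c v n (JD := JD) ∧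
        blkB (matA F E c v n (m * u * m⁻¹)) = (toLocalRing E v a * toLocalRing E v a) • blkB (matA F E c v n u)) ∧
      (∀ u ∈ unipDeltaLocal F E c v n (JD := JD), m⁻¹ * u * m ∈ unipDeltaLocal F E c v n (JD := JD) ∧
        blkB (matA F E c v n (m⁻¹ * u * m)) = (toLocalRing E v a⁻¹ * toLocalRing E v a⁻¹) • blkB (matA F E c v n u)) := by
  set α : LocalRing E v := toLocalRing E v a with hα
  set β : LocalRing E v := toLocalRing E v a⁻¹ with hβ
  have hαβ : α * β = 1 := by rw [hα, hβ, ← map_mul, mul_inv_cancel₀ ha, map_one]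
  have hβα : β * α = 1 := by rw [mul_comm, hαβ]
  have hβ' : toLocalRing E v a⁻¹⁻¹ = α := by rw [inv_inv]
  set m := ofAdapted F E c v n hJD _ (isUnit_det_leviScalar F E v n ha) (cstar_leviScalar F E c v n ha) with hm
  set m' := ofAdapted F E c v n hJD _ (isUnit_det_leviScalar F E v n (inv_ne_zero ha)) (cstar_leviScalar F E c v n (inv_ne_zero ha)) with hm'
  have hYm : adapt (matA F E c v n m) = Matrix.fromBlocks (α • 1) 0 0 (β • 1) := adapt_matA_ofAdapted F E c v n hJD _ _ _
  have hYm' : adapt (matA F E c v n m') = Matrix.fromBlocks (β • 1) 0 0 (α • 1) := by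
    rw [hm', adapt_matA_ofAdapted, hβ']
  have hmm' : m * m' = 1 := by
    refine matA_injective F E c v n (eq_of_adapt_eq ?_)
    rw [← matA_mul, adapt_mul, hYm, hYm', matA_one, adapt_one, Matrix.fromBlocks_multiply]
    simp only [Matrix.smul_mul, Matrix.mul_smul, Matrix.one_mul, Matrix.zero_mul, Matrix.mul_zero, smul_zero, add_zero, zero_add, smul_smul, hαβ, hβα,
      one_smul, Matrix.fromBlocks_one]
  have hminv : m⁻¹ = m' := inv_eq_of_mul_eq_one_right hmm'
  have hw : adapt (matA F E c v n (weylDelta F E c v n hJD (T₀ := T₀))) = Matrix.fromBlocks 0 1 1 0 := adapt_matA_weylDelta F E c v n hJD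
  -- conjugation of a unipotent element
  have hconj : ∀ (x y : LocalRing E v), x * y = 1 → ∀ {g g' : UnitaryGroup.localPi E c (n + n) JD v},
      adapt (matA F E c v n g) = Matrix.fromBlocks (x • 1) 0 0 (y • 1) → adapt (matA F E c v n g') = Matrix.fromBlocks (y • 1) 0 0 (x • 1) →
      ∀ u ∈ unipDeltaLocal F E c v n (JD := JD), g * u * g' ∈ unipDeltaLocal F E c v n (JD := JD) ∧
        blkB (matA F E c v n (g * u * g')) = (x * x) • blkB (matA F E c v n u) := by
    intro x y hxy g g' hg hg' u hu
    obtain ⟨t, ht⟩ := (mem_unipDeltaLocal_iff F E c v n u).1 hu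
    have hprod : adapt (matA F E c v n (g * u * g')) = Matrix.fromBlocks 1 ((x * x) • t) 0 1 := by
      rw [← matA_mul, ← matA_mul, adapt_mul, adapt_mul, hg, ht, hg', Matrix.fromBlocks_multiply, Matrix.fromBlocks_multiply]
      have hyx : y * x = 1 := by rw [mul_comm, hxy]
      simp only [Matrix.smul_mul, Matrix.mul_smul, Matrix.one_mul, Matrix.mul_one, Matrix.zero_mul, Matrix.mul_zero, smul_zero, add_zero, zero_add,
        smul_smul, hxy, hyx, one_smul]
    refine ⟨(mem_unipDeltaLocal_iff F E c v n _).2 ⟨_, hprod⟩, ?_⟩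
    have hB : blkB (matA F E c v n u) = t := by
      have := ht; rw [adapt_eq] at this; exact (Matrix.fromBlocks_inj.1 this).2.1
    rw [adapt_eq] at hprod
    rw [(Matrix.fromBlocks_inj.1 hprod).2.1, hB]
  refine ⟨m, m', isSiegelDelta_ofAdapted_fromBlocks F E c hcδ hδ hd v n hT₀ hJD _ _ _ _ _,
    isSiegelDelta_ofAdapted_fromBlocks F E c hcδ hδ hd v n hT₀ hJD _ _ _ _ _, hmm', ?_, ?_, ?_⟩
  · refine matA_injective F E c v n (eq_of_adapt_eq ?_)
    rw [← matA_mul, ← matA_mul, adapt_mul, adapt_mul, hYm, hYm', hw, Matrix.fromBlocks_multiply, Matrix.fromBlocks_multiply]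
    simp only [Matrix.mul_smul, Matrix.mul_one, Matrix.mul_zero, smul_zero, add_zero, zero_add]
  · intro u hu
    rw [hminv]
    exact hconj α β hαβ hYm hYm' u hu
  · intro u hu
    rw [hminv]
    have h := hconj β α hβα hYm' hYm u hu
    simpa only [mul_assoc] using h

end Summit.HodgeConjecture.HodgeConjecture.Cruxes.HLiu418.K2LiuLocalSWLeviScalars

end
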